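import Literature.Analysis.FluidPDE.BiotSavart2DContinuity
import Literature.Analysis.FluidPDE.BiotSavart2DQuasiLipschitz
import Literature.Analysis.FluidPDE.GaussWeightedBiotSavartBounds
import Mathlib.Analysis.SpecialFunctions.Integrals.Basic
import HarnessLib

/-!
# The sup of a planar Biot–Savart velocity by the `L¹` and `L⁴` norms of the vorticity
# (Gallay–Wayne 2002, Lemma 2.1 (b), the case `p = 1`, `q = 4`, with explicit constants)

Literature file (topic `Analysis/FluidPDE`), all results proved, no definitions, no named facts.
The printed statement (Th. Gallay, C. E. Wayne, Arch. Ration. Mech. Anal. 163 (2002),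
Lemma 2.1 (b), materialised text p. 6):

> Let `u` be the velocity field obtained from `ω` via the Biot–Savart law. (b) Assume that
> `1 ≤ p < 2 < q ≤ ∞`, and define `α ∈ (0,1)` by the relation `1/2 = α/p + (1−α)/q`. If
> `ω ∈ L^p(ℝ²) ∩ L^q(ℝ²)`, then `u ∈ L^∞(ℝ²)²`, and there exists `C > 0` such that
> `|u|_∞ ≤ C |ω|_p^α |ω|_q^{1−α}`.

Here the case `p = 1`, `q = 4` (`α = 1/3`) is proved in the CUT-OFF form from which it follows
by optimising the radius, with explicit constants, for the tree's planar Biot–Savart law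
`biotSavart2D w x = ∫ w(y) K₂(x − y) dy` (`GaussianVortexPlanar`; `‖K₂(z)‖ = (2π‖z‖)⁻¹`):

* §1 (private) the radial integral `∫_{|z|<R} |z|^{-s} dz = 2π R^{2−s}/(2−s)` on `ℝ²` for `s < 2`
  and its integrability (polar coordinates, the tree's `integral_indicator_comp_norm`);
* §2 `integral_abs_mul_indicator_inv_norm_le_L4` — the Hölder step
  `∫ |w(y)| 𝟙_{|x−y|<R}|x−y|⁻¹ dy ≤ ‖w‖_{L⁴} (3π R^{2/3})^{3/4}`
  (`‖𝟙_{|z|<R}|z|⁻¹‖_{L^{4/3}}^{4/3} = ∫_{|z|<R}|z|^{−4/3} = 3π R^{2/3}`), and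
  **`norm_biotSavart2D_le_of_radius_L4`**: for a continuous `w ∈ L¹ ∩ L⁴(ℝ²)`, every `R > 0`
  and every `x`,
  `‖(K₂ ∗ w)(x)‖ ≤ (2π)⁻¹ ((3π R^{2/3})^{3/4} ‖w‖_{L⁴} + R⁻¹ ‖w‖_{L¹})`
  — MB's split `K₂ = 𝟙_{|z|<R} K₂ + 𝟙_{|z|≥R} K₂` (Prop. 8.2 (i), (8.27); the tree's
  `norm_biotSavart2D_le_of_radius` is the `L^∞ × L¹` version) with Hölder `L⁴ × L^{4/3}` on the
  inner piece; `(3π R^{2/3})^{3/4} = (3π)^{3/4} R^{1/2}`, so the choice `R = (‖w‖₁/‖w‖₄)^{2/3}`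
  gives the printed `|u|_∞ ≤ C |ω|₁^{1/3} |ω|₄^{2/3}`; the cut-off form is what the time-decay
  application (`PlanarVelocityDecay`) uses, with `R ∼ (ν t)^{1/2}`.

No boundedness of `w` is assumed: the inner integrand `|w| 𝟙|x−y|⁻¹` is integrable by Young's
inequality `ab ≤ a⁴/4 + (3/4) b^{4/3}`.

## References

* [GallayWayne2002] Th. Gallay, C. E. Wayne, *Invariant manifolds and the long-time asymptotics
  of the Navier–Stokes and vorticity equations on ℝ²*, Arch. Ration. Mech. Anal. 163 (2002)
  209–258 = arXiv:math/0102197 — Lemma 2.1 (b) (materialised text p. 6).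
* [MajdaBertozziCUP2002] A. J. Majda, A. L. Bertozzi, *Vorticity and Incompressible Flow*, CUP
  2002 — §8.2.3 Prop. 8.2 (i), eq. (8.27) (held text p. 275): the cut-off split.
-/


noncomputable section

open MeasureTheory Set Function Filter Metric
open _root_.Topology
open scoped ENNReal Topology

namespace Literature.Analysis.FluidPDE

/-! ### §1 The radial integral `∫_{|z|<R} |z|^{-s} dz = 2π R^{2−s}/(2−s)` on `ℝ²` (`s < 2`) -/

section Radial

/-- **`∫_{|z| < R} |z|^{-s} dz = 2π R^{2−s}/(2 − s)`** on `ℝ²` for `s < 2`, `R ≥ 0` (polar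
coordinates: `2π ∫₀^R r^{1−s} dr`). [folklore] -/
private theorem integral_indicator_ball_norm_rpow_neg {s R : ℝ} (hs : s < 2) (hR : 0 ≤ R) :
    ∫ z, (ball (0 : EuclideanSpace ℝ (Fin 2)) R).indicator (fun z => ‖z‖ ^ (-s)) z =
      2 * Real.pi * R ^ (2 - s) / (2 - s) := by
  have h1 : (fun z => (ball (0 : EuclideanSpace ℝ (Fin 2)) R).indicator (fun z => ‖z‖ ^ (-s)) z) =
      fun z : EuclideanSpace ℝ (Fin 2) => (Iio R).indicator (fun y => y ^ (-s)) ‖z‖ := by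
    ext z
    by_cases hz : ‖z‖ < R
    · rw [indicator_of_mem (mem_ball_zero_iff.2 hz), indicator_of_mem (mem_Iio.2 hz)]
    · rw [indicator_of_notMem (fun h => hz (mem_ball_zero_iff.1 h)),
        indicator_of_notMem (fun h => hz (mem_Iio.1 h))]
  rw [h1, integral_indicator_comp_norm _ measurableSet_Iio, Ioi_inter_Iio]
  have h3 : ∫ y in Ioo (0 : ℝ) R, y * y ^ (-s) = ∫ y in Ioo (0 : ℝ) R, y ^ (1 - s) :=
    setIntegral_congr_fun measurableSet_Ioo fun y hy => by
      rw [show (1 : ℝ) - s = 1 + (-s) by ring, Real.rpow_add hy.1, Real.rpow_one]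
  have hs' : -1 < 1 - s := by linarith
  rw [h3, setIntegral_congr_set Ioo_ae_eq_Ioc, ← intervalIntegral.integral_of_le hR,
    integral_rpow (Or.inl hs'), Real.zero_rpow (by linarith), sub_zero,
    show (1 : ℝ) - s + 1 = 2 - s by ring]
  ring

/-- `𝟙_{|z|<R} |z|^{-s} ∈ L¹(ℝ²)` for `s < 2`. [folklore] -/
private theorem integrable_indicator_ball_norm_rpow_neg {s : ℝ} (hs : s < 2) (R : ℝ) :
    Integrable ((ball (0 : EuclideanSpace ℝ (Fin 2)) R).indicator fun z => ‖z‖ ^ (-s)) := by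
  refine IntegrableOn.integrable_indicator ?_ measurableSet_ball
  have h := integrableOn_fun_norm_addHaar (volume : Measure (EuclideanSpace ℝ (Fin 2)))
    (f := fun y : ℝ => y ^ (-s)) (r := R)
  rw [finrank_euclideanSpace_fin] at h
  refine h.2 ?_
  have hs' : -1 < 1 - s := by linarith
  have hI : IntegrableOn (fun y : ℝ => y ^ (1 - s)) (Ioo 0 R) := by
    rcases le_or_gt R 0 with hR | hR
    · rw [Ioo_eq_empty (not_lt.2 hR)]; exact integrableOn_empty
    · exact (intervalIntegrable_iff_integrableOn_Ioo_of_le hR.le).1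
        (intervalIntegral.intervalIntegrable_rpow' hs')
  refine hI.congr_fun (fun y hy => ?_) measurableSet_Ioo
  simp only [smul_eq_mul]
  rw [show (2 : ℕ) - 1 = 1 from rfl, pow_one, show (1 : ℝ) - s = 1 + (-s) by ring,
    Real.rpow_add hy.1, Real.rpow_one]

end Radial

/-! ### §2 The Biot–Savart sup bound by `‖ω‖_{L⁴}` and `‖ω‖_{L¹}` -/

section SupBound

variable {w : EuclideanSpace ℝ (Fin 2) → ℝ} {A : ℝ}

/-- The `L⁴ × L^{4/3}` Hölder step of the Biot–Savart bound: for a continuous `w` with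
`∫ w⁴ < ∞` and every `R > 0`, `x`:
`∫ |w(y)| 𝟙_{|x−y|<R} |x−y|⁻¹ dy ≤ (∫ w⁴)^{1/4} (3π R^{2/3})^{3/4}`
(`‖𝟙_{|z|<R}|z|⁻¹‖_{L^{4/3}}^{4/3} = ∫_{|z|<R} |z|^{-4/3} = 3π R^{2/3}`).
[cite: GallayWayne2002, Lemma 2.1 (b) (proof, Hölder step; materialised text p. 6)] -/
theorem integral_abs_mul_indicator_inv_norm_le_L4 (hw : Continuous w)
    (h4 : Integrable fun y => w y ^ 4) {R : ℝ} (hR : 0 < R) (x : EuclideanSpace ℝ (Fin 2)) :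
    ∫ y, |w y| * indicator (ball (0 : EuclideanSpace ℝ (Fin 2)) R) (fun z => ‖z‖⁻¹) (x - y) ≤
      (∫ y, w y ^ 4) ^ (1 / 4 : ℝ) * (3 * Real.pi * R ^ (2 / 3 : ℝ)) ^ (3 / 4 : ℝ) := by
  set g : EuclideanSpace ℝ (Fin 2) → ℝ := fun y =>
    indicator (ball (0 : EuclideanSpace ℝ (Fin 2)) R) (fun z => ‖z‖⁻¹) (x - y) with hg
  have hg0 : ∀ y, 0 ≤ g y := fun y => indicator_nonneg (fun z _ => by positivity) _
  have hpq : Real.HolderConjugate 4 (4 / 3) := Real.holderConjugate_iff.2 ⟨by norm_num, by norm_num⟩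
  -- `|w| ∈ L⁴`
  have hwm : AEStronglyMeasurable (fun y => |w y|) volume := hw.abs.aestronglyMeasurable
  have hf : MemLp (fun y => |w y|) (ENNReal.ofReal 4) volume := by
    rw [← integrable_norm_rpow_iff hwm (by simp) (by simp), ENNReal.toReal_ofReal (by norm_num)]
    refine h4.congr (Eventually.of_forall fun y => ?_)
    dsimp only
    rw [Real.norm_eq_abs, abs_abs, show (4 : ℝ) = ((4 : ℕ) : ℝ) by norm_num, Real.rpow_natCast,
      pow_abs, abs_of_nonneg (by positivity)]
  -- `g ∈ L^{4/3}` with `∫ g^{4/3} = 3π R^{2/3}`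
  have hg43 : ∀ y, g y ^ (4 / 3 : ℝ) =
      indicator (ball (0 : EuclideanSpace ℝ (Fin 2)) R) (fun z => ‖z‖ ^ (-(4 / 3 : ℝ))) (x - y) := by
    intro y
    simp only [hg]
    by_cases hmem : x - y ∈ ball (0 : EuclideanSpace ℝ (Fin 2)) R
    · rw [indicator_of_mem hmem, indicator_of_mem hmem, Real.inv_rpow (norm_nonneg _),
        Real.rpow_neg (norm_nonneg _)]
    · rw [indicator_of_notMem hmem, indicator_of_notMem hmem,
        Real.zero_rpow (by norm_num)]
  have hgI : Integrable (fun y => g y ^ (4 / 3 : ℝ)) volume := by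
    have h := (integrable_indicator_ball_norm_rpow_neg (s := 4 / 3) (by norm_num) R).comp_sub_left x
    exact h.congr (Eventually.of_forall fun y => (hg43 y).symm)
  have hgm : AEStronglyMeasurable g volume := by
    have hmeas : Measurable fun z : EuclideanSpace ℝ (Fin 2) =>
        indicator (ball (0 : EuclideanSpace ℝ (Fin 2)) R) (fun z => ‖z‖⁻¹) z :=
      (continuous_norm.measurable.inv).indicator measurableSet_ball
    exact (hmeas.comp (measurable_const.sub measurable_id)).aestronglyMeasurable
  have hgmem : MemLp g (ENNReal.ofReal (4 / 3)) volume := by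
    rw [← integrable_norm_rpow_iff hgm (by simp) (by simp),
      ENNReal.toReal_ofReal (by norm_num)]
    refine hgI.congr (Eventually.of_forall fun y => ?_)
    dsimp only
    rw [Real.norm_of_nonneg (hg0 y)]
  have hval : ∫ y, g y ^ (4 / 3 : ℝ) = 3 * Real.pi * R ^ (2 / 3 : ℝ) := by
    rw [integral_congr_ae (Eventually.of_forall hg43),
      integral_sub_left_eq_self
        (indicator (ball (0 : EuclideanSpace ℝ (Fin 2)) R) fun z => ‖z‖ ^ (-(4 / 3 : ℝ))) volume x,
      integral_indicator_ball_norm_rpow_neg (by norm_num) hR.le]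
    rw [show (2 : ℝ) - 4 / 3 = 2 / 3 by norm_num]
    ring
  -- Hölder
  have hH := integral_mul_le_Lp_mul_Lq_of_nonneg hpq (Eventually.of_forall fun y => abs_nonneg _)
    (Eventually.of_forall hg0) hf hgmem
  have e4 : ∫ y, |w y| ^ (4 : ℝ) = ∫ y, w y ^ 4 :=
    integral_congr_ae (Eventually.of_forall fun y => by
      dsimp only
      rw [show (4 : ℝ) = ((4 : ℕ) : ℝ) by norm_num, Real.rpow_natCast, pow_abs,
        abs_of_nonneg (by positivity)])
  rw [e4, hval, show (1 : ℝ) / (4 / 3) = 3 / 4 by norm_num] at hH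
  exact hH

/-- **Gallay–Wayne 2002, Lemma 2.1 (b) for `(p, q) = (1, 4)`, cut-off form with explicit
constants.** For a continuous bounded vorticity `w ∈ L¹(ℝ²)` with `∫ w⁴ < ∞`, the Biot–Savart
velocity `v = K₂ ∗ w` satisfies, for every `R > 0` and every `x`,
`‖v(x)‖ ≤ (2π)⁻¹ ((3π R^{2/3})^{3/4} (∫ w⁴)^{1/4} + R⁻¹ ‖w‖_{L¹})`
(MB's split `K₂ = 𝟙_{|z|<R}K₂ + 𝟙_{|z|≥R}K₂` with Hölder `L⁴ × L^{4/3}` on the inner part instead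
of `L^∞ × L¹`). [cite: GallayWayne2002, Lemma 2.1 (b) (p = 1, q = 4; materialised text p. 6)] -/
theorem norm_biotSavart2D_le_of_radius_L4 (hw : Continuous w) (hwi : Integrable w)
    (h4 : Integrable fun y => w y ^ 4) {R : ℝ} (hR : 0 < R) (x : EuclideanSpace ℝ (Fin 2)) :
    ‖biotSavart2D w x‖ ≤ (2 * Real.pi)⁻¹ *
      ((3 * Real.pi * R ^ (2 / 3 : ℝ)) ^ (3 / 4 : ℝ) * (∫ y, w y ^ 4) ^ (1 / 4 : ℝ) +
        R⁻¹ * ∫ y, |w y|) := by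
  have hπ : 0 < (2 * Real.pi)⁻¹ := by positivity
  set g : EuclideanSpace ℝ (Fin 2) → ℝ := fun y =>
    indicator (ball (0 : EuclideanSpace ℝ (Fin 2)) R) (fun z => ‖z‖⁻¹) (x - y) with hg
  have hg0 : ∀ y, 0 ≤ g y := fun y => indicator_nonneg (fun z _ => by positivity) _
  -- the inner integrand `|w| g` is integrable: `|w| g ≤ w⁴/4 + (3/4) g^{4/3} ≤ w⁴ + g^{4/3}` (Young)
  have hg43 : ∀ y, g y ^ (4 / 3 : ℝ) =
      indicator (ball (0 : EuclideanSpace ℝ (Fin 2)) R) (fun z => ‖z‖ ^ (-(4 / 3 : ℝ))) (x - y) := by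
    intro y
    simp only [hg]
    by_cases hmem : x - y ∈ ball (0 : EuclideanSpace ℝ (Fin 2)) R
    · rw [indicator_of_mem hmem, indicator_of_mem hmem, Real.inv_rpow (norm_nonneg _),
        Real.rpow_neg (norm_nonneg _)]
    · rw [indicator_of_notMem hmem, indicator_of_notMem hmem,
        Real.zero_rpow (by norm_num)]
  have hgI : Integrable (fun y => g y ^ (4 / 3 : ℝ)) volume := by
    have h := (integrable_indicator_ball_norm_rpow_neg (s := 4 / 3) (by norm_num) R).comp_sub_left x
    exact h.congr (Eventually.of_forall fun y => (hg43 y).symm)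
  have hgm : AEStronglyMeasurable g volume := by
    have hmeas : Measurable fun z : EuclideanSpace ℝ (Fin 2) =>
        indicator (ball (0 : EuclideanSpace ℝ (Fin 2)) R) (fun z => ‖z‖⁻¹) z :=
      (continuous_norm.measurable.inv).indicator measurableSet_ball
    exact (hmeas.comp (measurable_const.sub measurable_id)).aestronglyMeasurable
  have hI1 : Integrable (fun y => |w y| * g y) volume := by
    refine Integrable.mono' (h4.add hgI) (hw.abs.aestronglyMeasurable.mul hgm)
      (Eventually.of_forall fun y => ?_)
    rw [Real.norm_of_nonneg (mul_nonneg (abs_nonneg _) (hg0 y))]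
    -- Young: `a b ≤ a⁴/4 + (3/4) b^{4/3}` for `a, b ≥ 0`
    have hyoung := Real.young_inequality_of_nonneg (abs_nonneg (w y)) (hg0 y)
      (Real.holderConjugate_iff.2 ⟨by norm_num, by norm_num⟩ : Real.HolderConjugate 4 (4 / 3))
    have e1 : |w y| ^ (4 : ℝ) = w y ^ 4 := by
      rw [show (4 : ℝ) = ((4 : ℕ) : ℝ) by norm_num, Real.rpow_natCast, pow_abs,
        abs_of_nonneg (by positivity)]
    rw [e1] at hyoung
    have h0a : 0 ≤ w y ^ 4 := by positivity
    have h0b : 0 ≤ g y ^ (4 / 3 : ℝ) := Real.rpow_nonneg (hg0 y) _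
    calc |w y| * g y ≤ w y ^ 4 / 4 + g y ^ (4 / 3 : ℝ) / (4 / 3) := hyoung
      _ ≤ w y ^ 4 + g y ^ (4 / 3 : ℝ) := by linarith
  -- the split `|x−y|⁻¹ ≤ g(y) + R⁻¹` and MB's bound `‖v(x)‖ ≤ (2π)⁻¹ ∫ |w||x−y|⁻¹`
  have hsplit : ∀ y, |w y| * ‖x - y‖⁻¹ ≤ |w y| * g y + R⁻¹ * |w y| := by
    intro y
    have h0 : 0 ≤ |w y| := abs_nonneg _
    by_cases hxy : ‖x - y‖ < R
    · have : g y = ‖x - y‖⁻¹ := by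
        simp only [hg]; rw [indicator_of_mem (mem_ball_zero_iff.2 hxy)]
      rw [this]
      linarith [mul_nonneg (inv_nonneg.2 hR.le) h0]
    · have h2 : ‖x - y‖⁻¹ ≤ R⁻¹ := inv_anti₀ hR (not_lt.1 hxy)
      have : g y = 0 := by
        simp only [hg]; rw [indicator_of_notMem (fun h => hxy (mem_ball_zero_iff.1 h))]
      rw [this, mul_zero, zero_add, mul_comm R⁻¹]
      exact mul_le_mul_of_nonneg_left h2 h0
  have hle : ∫ y, |w y| * ‖x - y‖⁻¹ ≤ (∫ y, |w y| * g y) + R⁻¹ * ∫ y, |w y| := by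
    rw [← integral_const_mul, ← integral_add hI1 (hwi.abs.const_mul _)]
    exact integral_mono_of_nonneg (Eventually.of_forall fun y => by positivity)
      (hI1.add (hwi.abs.const_mul _)) (Eventually.of_forall hsplit)
  have hH := integral_abs_mul_indicator_inv_norm_le_L4 hw h4 hR x
  calc ‖biotSavart2D w x‖ ≤ (2 * Real.pi)⁻¹ * ∫ y, |w y| * ‖x - y‖⁻¹ :=
        norm_biotSavart2D_le_integral w x
    _ ≤ (2 * Real.pi)⁻¹ * ((∫ y, |w y| * g y) + R⁻¹ * ∫ y, |w y|) :=
        mul_le_mul_of_nonneg_left hle hπ.le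
    _ ≤ (2 * Real.pi)⁻¹ * ((3 * Real.pi * R ^ (2 / 3 : ℝ)) ^ (3 / 4 : ℝ) *
          (∫ y, w y ^ 4) ^ (1 / 4 : ℝ) + R⁻¹ * ∫ y, |w y|) := by
        gcongr
        rw [mul_comm]
        exact hH

end SupBound

end Literature.Analysis.FluidPDE
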